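import Summits.AtomisticToContinuum.HydrodynamicLimit.Theses.JParityClosure
import Literature.MathematicalPhysics.KineticTheory.EvenCollisionTubeFunctional
import Literature.MathematicalPhysics.KineticTheory.MicroscaleWindowFunctionals
import Literature.MathematicalPhysics.KineticTheory.EvenStatTruncationBound
import Summits.AtomisticToContinuum.HydrodynamicLimit.Theorems.JParityClosureEvenStressEnskogLocalGibbsReduction
import HarnessLib

/-!
# The pre-shock glue of `EvenStressEnskog` (line `preshock-kinetic-slaving` of the crux
# `JParityClosure.EvenStressEnskog`, stmt-AtomisticToContinuum-13079 — lead c7, S2 partial (b))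

**The pre-shock frame.**  The filed crux `EvenStressEnskog` quantifies over EVERY horizon `τ > 0` and every
forward local-Gibbs evolution, with no Euler solution and no `t = 0` law of large numbers; its only consumers
in the route (`ParityInBand`, `ParityBandClosure`) use the instances `0 < τ < T` tied to a classical hard-sphere
Euler solution `(ρ, u, θ)` on `[0, T)` through the `t = 0` LLN — literally the frame of the sibling crux
`OddContactSymmetry` and of the support `KineticEnergyTails`.  The planners' recommended repair is to RESTATE
the crux in that pre-shock, data-tied frame (`EvenStressEnskogPreShock`) and to SPLIT it into its two-body core
`ContactEvenPreShock` (collision sum of the six J-even marks `Ξ_P^{kl}` ≈ the fully Maxwellian Enskog prediction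
`contactPredM`) and the one-body statement `VelocityEquilibrationPreShock` (the `r`-ball empirical velocity law
tested on quadratic-growth `F(v, u_r, θ_r)` ≈ its local-Maxwellian prediction) — see the skeleton
`Cruxes/EvenStressEnskog/Lines/preshock_kinetic_slaving.lean`, §1–§2, which carries these as named `Prop`s.

A Theorems file cannot import a `Lines/` file and must not define `Prop`s, so this definition-free file SPELLS
OUT the four bodies as hypotheses / conclusions (pattern of `evenStressEnskog_of_sides`,
`contactSide_of_evenStressEnskog_of_enskogSide` in `…LocalGibbsReduction`) and records the glue, sorry-free:

* `preShock_of_evenStressEnskog` — the filed crux implies its pre-shock form (the Euler solution, the LLN and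
  `τ < T` are discarded);
* `evenStressEnskogPreShock_of_sides` — the pre-shock crux from its pre-shock CONTACT SIDE and ENSKOG SIDE
  (union bound `{η < |K − E|} ⊆ {η/2 < |K − C|} ∪ {η/2 < |C − E|}` pair by pair, `lgr_exists_r₀_N₀_forall_fin3`);
* `enskogSidePreShock_of_velocityEquilibrationPreShock` — the pre-shock Enskog side IS the pre-shock one-body
  statement for the weight `g·Ỹ·a` and the six test functions `F_{kl} = ∫_{S²}⟪v − u, ω⟫² ω_k ω_l dσ`
  (exact identity `contactPredM_sub_enskog_eq_oneBodyPred_sub_oneBodyStat` on good configurations,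
  `stub_enskogPointwise`, null bad set `localGibbsLaw_compl_good`, analytic clamp `exists_contactValue_clamp`);
* `evenStressEnskogPreShock_of_contact_of_velocityEquilibration` — **the `--glue-by` theorem of the recommended
  split `EvenStressEnskogPreShock ⇐ ContactEvenPreShock ∧ VelocityEquilibrationPreShock`**: the composition of the
  two previous items;
* `evenStressEnskog_of_frameGap_of_contact_of_velocityEquilibration` — the whole line, definition-free: with the
  frame gap `EvenStressEnskogPreShock → EvenStressEnskog` as a HYPOTHESIS (it is `id` after the restatement), the
  two children give the filed crux.

No new mathematics: these are the landed `∀ τ` proofs re-threaded with the extra binders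
`T ρ θ u, hEuler, Φ, hLLN, τ, hτ, hτT`.

References: S. Chapman, T. G. Cowling, *The Mathematical Theory of Non-Uniform Gases* (1970), Ch. 16;
H. Spohn, *Large Scale Dynamics of Interacting Particles* (1991), Part I §3.2; H. van Beijeren, M. H. Ernst,
*The modified Enskog equation*, Physica 68 (1973).
-/

noncomputable section

namespace Summit.AtomisticToContinuum.HydrodynamicLimit.Theorems.EvenStressEnskog

open scoped BigOperators InnerProductSpace Topology ENNReal
open MeasureTheory Filter Set
open Literature.MathematicalPhysics.KineticTheory Literature.Analysis.FluidPDE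
open Literature.MathematicalPhysics.KineticTheory.StationaryMicroscale
open Summit.AtomisticToContinuum.HydrodynamicLimit.Theses.JParityClosure

/-- **THE FILED CRUX IMPLIES ITS PRE-SHOCK FORM.**  Conclusion (spelled out) = the skeleton's
`EvenStressEnskogPreShock`: the filed body (`evenStat = collisionSum − σ³∫enskogRate` of the six even marks small
in local-Gibbs probability), but after `σ < σ₀` quantified over a classical hard-sphere Euler solution `(ρ,u,θ)` on
`[0,T)`, over flow families whose local-Gibbs fields satisfy the `t = 0` LLN towards it, and with `0 < τ < T`.  The
Euler solution, the LLN and `τ < T` are simply discarded (the skeleton's `preShock_of_crux`); the converse is the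
line's frame gap. [folklore] -/
theorem preShock_of_evenStressEnskog (h : EvenStressEnskog) :
    ∃ η₀ : ℝ, 0 < η₀ ∧ ∀ (a₀ θ₀ : T3 → ℝ) (u₀ : T3 → V3), Continuous a₀ → Continuous θ₀ → Continuous u₀ →
      (∀ x, 0 < a₀ x) → (∀ x, 0 < θ₀ x) → ∃ σ₀ : ℝ, 0 < σ₀ ∧ ∀ σ : ℝ, 0 < σ → σ < σ₀ →
      ∀ (T : ℝ) (ρ θ : ℝ → T3 → ℝ) (u : ℝ → T3 → V3), IsHardSphereEulerSolution σ T ρ u θ →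
      ∀ Φ : (N : ℕ) → HardSphereFlow (Torus.geometry (Fin 3)) (hsDiameter σ N) (N + 1),
      TendstoHydroFieldsAt (fun N => localGibbsLaw σ a₀ u₀ θ₀ N (Φ N)) Φ ρ u θ 0 →
      ∀ τ : ℝ, 0 < τ → τ < T →
      ∀ χ : ℝ × T3 → ℝ, Continuous χ → ∀ g : ℝ → ℝ, Continuous g → (∀ a, η₀ ≤ a → g a = 0) →
      ∀ η δ : ℝ, 0 < η → 0 < δ → ∃ r₀ : ℝ, 0 < r₀ ∧ ∀ r : ℝ, 0 < r → r < r₀ → ∃ N₀ : ℕ, ∀ N : ℕ, N₀ ≤ N →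
      ∀ k l : Fin 3,
        localGibbsLaw σ a₀ u₀ θ₀ N (Φ N) {z | η < |evenStat σ N (Φ N) τ χ g (evenMark k l) r z|}
          ≤ ENNReal.ofReal δ := by
  have h' :
      ∃ η₀ : ℝ, 0 < η₀ ∧ ∀ (a₀ θ₀ : T3 → ℝ) (u₀ : T3 → V3), Continuous a₀ → Continuous θ₀ → Continuous u₀ →
        (∀ x, 0 < a₀ x) → (∀ x, 0 < θ₀ x) → ∃ σ₀ : ℝ, 0 < σ₀ ∧ ∀ σ : ℝ, 0 < σ → σ < σ₀ →
        ∀ Φ : (N : ℕ) → HardSphereFlow (Torus.geometry (Fin 3)) (hsDiameter σ N) (N + 1),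
        ∀ τ : ℝ, 0 < τ → ∀ χ : ℝ × UnitAddTorus (Fin 3) → ℝ, Continuous χ → ∀ g : ℝ → ℝ, Continuous g →
        (∀ a, η₀ ≤ a → g a = 0) →
        ∀ η δ : ℝ, 0 < η → 0 < δ → ∃ r₀ : ℝ, 0 < r₀ ∧ ∀ r : ℝ, 0 < r → r < r₀ →
        ∃ N₀ : ℕ, ∀ N : ℕ, N₀ ≤ N → ∀ k l : Fin 3,
          localGibbsLaw σ a₀ u₀ θ₀ N (Φ N) {z | η < |evenStat σ N (Φ N) τ χ g (evenMark k l) r z|}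
            ≤ ENNReal.ofReal δ := h
  obtain ⟨η₀, hη₀, H⟩ := h'
  refine ⟨η₀, hη₀, fun a₀ θ₀ u₀ ha hθ hu ha0 hθ0 => ?_⟩
  obtain ⟨σ₀, hσ₀, H⟩ := H a₀ θ₀ u₀ ha hθ hu ha0 hθ0
  refine ⟨σ₀, hσ₀, fun σ hσ hσ' _T _ρ _θ _u _hE Φ _hLLN τ hτ _hτT => ?_⟩
  exact H σ hσ hσ' Φ τ hτ

/-- **THE PRE-SHOCK CRUX FROM ITS PRE-SHOCK CONTACT SIDE AND ENSKOG SIDE.**  Hypotheses (spelled out): `hC` =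
the skeleton's `ContactEvenPreShock` (collision sum of the even marks `Ξ_P^{kl}` ≈ the fully Maxwellian Enskog
prediction `contactPredM`), `hE` = the skeleton's `EnskogSidePreShock` (`contactPredM` ≈ the crux's own empirical
Enskog term `σ³∫₀^τ enskogRate ∘ Φ_s`), both in local-Gibbs probability in the pre-shock, data-tied frame with
`∀ k l` before `∀ η δ`; conclusion = `EvenStressEnskogPreShock`.  The landed union bound `evenStressEnskog_of_sides`
(`{η < |K − E|} ⊆ {η/2 < |K − C|} ∪ {η/2 < |C − E|}` pair by pair, thresholds `min η₀ / min σ₀ / min r₀ / max N₀`,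
`lgr_exists_r₀_N₀_forall_fin3`) re-threaded with the binders `T ρ θ u, hEuler, Φ, hLLN, τ, hτ, hτT`. [folklore] -/
theorem evenStressEnskogPreShock_of_sides
    (hC : ∃ η₀ : ℝ, 0 < η₀ ∧ ∀ (a₀ θ₀ : T3 → ℝ) (u₀ : T3 → V3), Continuous a₀ → Continuous θ₀ → Continuous u₀ →
      (∀ x, 0 < a₀ x) → (∀ x, 0 < θ₀ x) → ∃ σ₀ : ℝ, 0 < σ₀ ∧ ∀ σ : ℝ, 0 < σ → σ < σ₀ →
      ∀ (T : ℝ) (ρ θ : ℝ → T3 → ℝ) (u : ℝ → T3 → V3), IsHardSphereEulerSolution σ T ρ u θ →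
      ∀ Φ : (N : ℕ) → HardSphereFlow (Torus.geometry (Fin 3)) (hsDiameter σ N) (N + 1),
      TendstoHydroFieldsAt (fun N => localGibbsLaw σ a₀ u₀ θ₀ N (Φ N)) Φ ρ u θ 0 →
      ∀ τ : ℝ, 0 < τ → τ < T →
      ∀ χ : ℝ × T3 → ℝ, Continuous χ → ∀ g : ℝ → ℝ, Continuous g → (∀ a, η₀ ≤ a → g a = 0) →
      ∀ k l : Fin 3,
      ∀ η δ : ℝ, 0 < η → 0 < δ → ∃ r₀ : ℝ, 0 < r₀ ∧ ∀ r : ℝ, 0 < r → r < r₀ → ∃ N₀ : ℕ, ∀ N : ℕ, N₀ ≤ N →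
        localGibbsLaw σ a₀ u₀ θ₀ N (Φ N)
          {z | η < |collisionSum σ N (Φ N) τ χ g (evenMark k l) r z - contactPredM σ N (Φ N) τ χ g (evenMark k l) r z|}
          ≤ ENNReal.ofReal δ)
    (hE : ∃ η₀ : ℝ, 0 < η₀ ∧ ∀ (a₀ θ₀ : T3 → ℝ) (u₀ : T3 → V3), Continuous a₀ → Continuous θ₀ → Continuous u₀ →
      (∀ x, 0 < a₀ x) → (∀ x, 0 < θ₀ x) → ∃ σ₀ : ℝ, 0 < σ₀ ∧ ∀ σ : ℝ, 0 < σ → σ < σ₀ →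
      ∀ (T : ℝ) (ρ θ : ℝ → T3 → ℝ) (u : ℝ → T3 → V3), IsHardSphereEulerSolution σ T ρ u θ →
      ∀ Φ : (N : ℕ) → HardSphereFlow (Torus.geometry (Fin 3)) (hsDiameter σ N) (N + 1),
      TendstoHydroFieldsAt (fun N => localGibbsLaw σ a₀ u₀ θ₀ N (Φ N)) Φ ρ u θ 0 →
      ∀ τ : ℝ, 0 < τ → τ < T →
      ∀ χ : ℝ × T3 → ℝ, Continuous χ → ∀ g : ℝ → ℝ, Continuous g → (∀ a, η₀ ≤ a → g a = 0) →
      ∀ k l : Fin 3,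
      ∀ η δ : ℝ, 0 < η → 0 < δ → ∃ r₀ : ℝ, 0 < r₀ ∧ ∀ r : ℝ, 0 < r → r < r₀ → ∃ N₀ : ℕ, ∀ N : ℕ, N₀ ≤ N →
        localGibbsLaw σ a₀ u₀ θ₀ N (Φ N)
          {z | η < |contactPredM σ N (Φ N) τ χ g (evenMark k l) r z
                - σ ^ 3 * ∫ s in Set.Icc (0 : ℝ) τ, enskogRate σ N χ g (evenMark k l) r s ((Φ N).flow s z)|}
          ≤ ENNReal.ofReal δ) :
    ∃ η₀ : ℝ, 0 < η₀ ∧ ∀ (a₀ θ₀ : T3 → ℝ) (u₀ : T3 → V3), Continuous a₀ → Continuous θ₀ → Continuous u₀ →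
      (∀ x, 0 < a₀ x) → (∀ x, 0 < θ₀ x) → ∃ σ₀ : ℝ, 0 < σ₀ ∧ ∀ σ : ℝ, 0 < σ → σ < σ₀ →
      ∀ (T : ℝ) (ρ θ : ℝ → T3 → ℝ) (u : ℝ → T3 → V3), IsHardSphereEulerSolution σ T ρ u θ →
      ∀ Φ : (N : ℕ) → HardSphereFlow (Torus.geometry (Fin 3)) (hsDiameter σ N) (N + 1),
      TendstoHydroFieldsAt (fun N => localGibbsLaw σ a₀ u₀ θ₀ N (Φ N)) Φ ρ u θ 0 →
      ∀ τ : ℝ, 0 < τ → τ < T →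
      ∀ χ : ℝ × T3 → ℝ, Continuous χ → ∀ g : ℝ → ℝ, Continuous g → (∀ a, η₀ ≤ a → g a = 0) →
      ∀ η δ : ℝ, 0 < η → 0 < δ → ∃ r₀ : ℝ, 0 < r₀ ∧ ∀ r : ℝ, 0 < r → r < r₀ → ∃ N₀ : ℕ, ∀ N : ℕ, N₀ ≤ N →
      ∀ k l : Fin 3,
        localGibbsLaw σ a₀ u₀ θ₀ N (Φ N) {z | η < |evenStat σ N (Φ N) τ χ g (evenMark k l) r z|}
          ≤ ENNReal.ofReal δ := by
  obtain ⟨η₄, hη₄, H4⟩ := hC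
  obtain ⟨η₅, hη₅, H5⟩ := hE
  refine ⟨min η₄ η₅, lt_min hη₄ hη₅, ?_⟩
  intro a₀ θ₀ u₀ ha hθ hu ha0 hθ0
  obtain ⟨σ₄, hσ₄, H4⟩ := H4 a₀ θ₀ u₀ ha hθ hu ha0 hθ0
  obtain ⟨σ₅, hσ₅, H5⟩ := H5 a₀ θ₀ u₀ ha hθ hu ha0 hθ0
  refine ⟨min σ₄ σ₅, lt_min hσ₄ hσ₅, ?_⟩
  intro σ hσ hσlt T ρ θ u hEul Φ hLLN τ hτ hτT χ hχ g hg hg0 η δ hη hδ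
  have hσ4 : σ < σ₄ := lt_of_lt_of_le hσlt (min_le_left _ _)
  have hσ5 : σ < σ₅ := lt_of_lt_of_le hσlt (min_le_right _ _)
  have hg4 : ∀ a, η₄ ≤ a → g a = 0 := fun a h => hg0 a ((min_le_left _ _).trans h)
  have hg5 : ∀ a, η₅ ≤ a → g a = 0 := fun a h => hg0 a ((min_le_right _ _).trans h)
  have hη2 : 0 < η / 2 := by positivity
  have hδ2 : 0 < δ / 2 := by positivity
  -- per pair (k, l): thresholds from the contact side and the Enskog side, combined
  have hpair : ∀ k l : Fin 3, ∃ r₀ : ℝ, 0 < r₀ ∧ ∀ r : ℝ, 0 < r → r < r₀ → ∃ N₀ : ℕ, ∀ N : ℕ, N₀ ≤ N →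
      localGibbsLaw σ a₀ u₀ θ₀ N (Φ N) {z | η < |evenStat σ N (Φ N) τ χ g (evenMark k l) r z|}
        ≤ ENNReal.ofReal δ := by
    intro k l
    obtain ⟨r₄, hr₄, H4'⟩ := H4 σ hσ hσ4 T ρ θ u hEul Φ hLLN τ hτ hτT χ hχ g hg hg4 k l (η / 2) (δ / 2) hη2 hδ2
    obtain ⟨r₅, hr₅, H5'⟩ := H5 σ hσ hσ5 T ρ θ u hEul Φ hLLN τ hτ hτT χ hχ g hg hg5 k l (η / 2) (δ / 2) hη2 hδ2
    refine ⟨min r₄ r₅, lt_min hr₄ hr₅, fun r hr hrlt => ?_⟩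
    have hr4 : r < r₄ := lt_of_lt_of_le hrlt (min_le_left _ _)
    have hr5 : r < r₅ := lt_of_lt_of_le hrlt (min_le_right _ _)
    obtain ⟨N₄, H4''⟩ := H4' r hr hr4
    obtain ⟨N₅, H5''⟩ := H5' r hr hr5
    refine ⟨max N₄ N₅, fun N hN => ?_⟩
    have E4 := H4'' N ((le_max_left _ _).trans hN)
    have E5 := H5'' N ((le_max_right _ _).trans hN)
    set P := localGibbsLaw σ a₀ u₀ θ₀ N (Φ N)
    set K := fun z => collisionSum σ N (Φ N) τ χ g (evenMark k l) r z
    set C := fun z => contactPredM σ N (Φ N) τ χ g (evenMark k l) r z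
    set E := fun z => σ ^ 3 * ∫ s in Set.Icc (0 : ℝ) τ, enskogRate σ N χ g (evenMark k l) r s ((Φ N).flow s z)
    have hD : ∀ z, evenStat σ N (Φ N) τ χ g (evenMark k l) r z = K z - E z := fun z => rfl
    have hsub : {z | η < |evenStat σ N (Φ N) τ χ g (evenMark k l) r z|}
        ⊆ {z | η / 2 < |K z - C z|} ∪ {z | η / 2 < |C z - E z|} := by
      intro z hz
      simp only [Set.mem_setOf_eq, Set.mem_union] at hz ⊢
      rw [hD z] at hz
      by_contra hcon
      simp only [not_or, not_lt] at hcon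
      obtain ⟨h1', h2'⟩ := hcon
      have : |K z - E z| ≤ |K z - C z| + |C z - E z| := abs_sub_le (K z) (C z) (E z)
      linarith
    calc P {z | η < |evenStat σ N (Φ N) τ χ g (evenMark k l) r z|}
        ≤ P ({z | η / 2 < |K z - C z|} ∪ {z | η / 2 < |C z - E z|}) := measure_mono hsub
      _ ≤ P {z | η / 2 < |K z - C z|} + P {z | η / 2 < |C z - E z|} := measure_union_le _ _
      _ ≤ ENNReal.ofReal (δ / 2) + ENNReal.ofReal (δ / 2) := add_le_add E4 E5
      _ = ENNReal.ofReal δ := by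
          rw [← ENNReal.ofReal_add hδ2.le hδ2.le]
          congr 1
          ring
  exact lgr_exists_r₀_N₀_forall_fin3
    (P := fun k l r N => localGibbsLaw σ a₀ u₀ θ₀ N (Φ N)
      {z | η < |evenStat σ N (Φ N) τ χ g (evenMark k l) r z|} ≤ ENNReal.ofReal δ) hpair

/-- **THE PRE-SHOCK ENSKOG SIDE IS THE PRE-SHOCK ONE-BODY STATEMENT for the weight `g·Ỹ·a` and the test
functions `F_{kl}`.**  Hypothesis `hL1` (spelled out) = the skeleton's `VelocityEquilibrationPreShock`: the `r`-ball
empirical velocity law tested against continuous `F(v, u, θ)` of second-moment growth, read at its own parameters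
`(u_r, θ_r)`, is `η`-close in local-Gibbs probability to the Maxwellian prediction, pre-shock and data-tied;
conclusion = `EnskogSidePreShock`.  The landed identification `stub_enskogIdentification_of_pointwise
stub_enskogPointwise` re-threaded in the pre-shock frame: `η₀ := min η₀^{(L1)} η_Y` with `Ỹ` the analytic clamp of
`exists_contactValue_clamp`; on the good set `contactPredM − σ³∫₀^τ enskogRate = oneBodyPred (g·Ỹ·a) F_{kl} −
oneBodyStat (g·Ỹ·a) F_{kl}` EXACTLY (`contactPredM_sub_enskog_eq_oneBodyPred_sub_oneBodyStat`); the bad set is null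
(`localGibbsLaw_compl_good`). [folklore] -/
theorem enskogSidePreShock_of_velocityEquilibrationPreShock
    (hL1 : ∃ η₀ : ℝ, 0 < η₀ ∧ ∀ (a₀ θ₀ : T3 → ℝ) (u₀ : T3 → V3), Continuous a₀ → Continuous θ₀ → Continuous u₀ →
      (∀ x, 0 < a₀ x) → (∀ x, 0 < θ₀ x) → ∃ σ₀ : ℝ, 0 < σ₀ ∧ ∀ σ : ℝ, 0 < σ → σ < σ₀ →
      ∀ (T : ℝ) (ρ θ : ℝ → T3 → ℝ) (u : ℝ → T3 → V3), IsHardSphereEulerSolution σ T ρ u θ →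
      ∀ Φ : (N : ℕ) → HardSphereFlow (Torus.geometry (Fin 3)) (hsDiameter σ N) (N + 1),
      TendstoHydroFieldsAt (fun N => localGibbsLaw σ a₀ u₀ θ₀ N (Φ N)) Φ ρ u θ 0 →
      ∀ τ : ℝ, 0 < τ → τ < T →
      ∀ χ : ℝ × T3 → ℝ, Continuous χ → ∀ k : ℝ → ℝ, Continuous k → (∀ a, η₀ ≤ a → k a = 0) →
      ∀ F : V3 × V3 × ℝ → ℝ, Continuous F →
      (∃ C : ℝ, ∀ q, |F q| ≤ C * (1 + ‖q.1‖ ^ 2 + ‖q.2.1‖ ^ 2 + |q.2.2|)) →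
      ∀ η δ : ℝ, 0 < η → 0 < δ → ∃ r₀ : ℝ, 0 < r₀ ∧ ∀ r : ℝ, 0 < r → r < r₀ → ∃ N₀ : ℕ, ∀ N : ℕ, N₀ ≤ N →
        localGibbsLaw σ a₀ u₀ θ₀ N (Φ N)
          {z | η < |oneBodyStat σ N (Φ N) τ χ k F r z - oneBodyPred σ N (Φ N) τ χ k F r z|}
          ≤ ENNReal.ofReal δ) :
    ∃ η₀ : ℝ, 0 < η₀ ∧ ∀ (a₀ θ₀ : T3 → ℝ) (u₀ : T3 → V3), Continuous a₀ → Continuous θ₀ → Continuous u₀ →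
      (∀ x, 0 < a₀ x) → (∀ x, 0 < θ₀ x) → ∃ σ₀ : ℝ, 0 < σ₀ ∧ ∀ σ : ℝ, 0 < σ → σ < σ₀ →
      ∀ (T : ℝ) (ρ θ : ℝ → T3 → ℝ) (u : ℝ → T3 → V3), IsHardSphereEulerSolution σ T ρ u θ →
      ∀ Φ : (N : ℕ) → HardSphereFlow (Torus.geometry (Fin 3)) (hsDiameter σ N) (N + 1),
      TendstoHydroFieldsAt (fun N => localGibbsLaw σ a₀ u₀ θ₀ N (Φ N)) Φ ρ u θ 0 →
      ∀ τ : ℝ, 0 < τ → τ < T →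
      ∀ χ : ℝ × T3 → ℝ, Continuous χ → ∀ g : ℝ → ℝ, Continuous g → (∀ a, η₀ ≤ a → g a = 0) →
      ∀ k l : Fin 3,
      ∀ η δ : ℝ, 0 < η → 0 < δ → ∃ r₀ : ℝ, 0 < r₀ ∧ ∀ r : ℝ, 0 < r → r < r₀ → ∃ N₀ : ℕ, ∀ N : ℕ, N₀ ≤ N →
        localGibbsLaw σ a₀ u₀ θ₀ N (Φ N)
          {z | η < |contactPredM σ N (Φ N) τ χ g (evenMark k l) r z
                - σ ^ 3 * ∫ s in Set.Icc (0 : ℝ) τ, enskogRate σ N χ g (evenMark k l) r s ((Φ N).flow s z)|}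
          ≤ ENNReal.ofReal δ := by
  obtain ⟨η₁, hη₁, H1⟩ := hL1
  obtain ⟨ηY, hηY, Yt, hYt, hYeq⟩ := exists_contactValue_clamp
  refine ⟨min η₁ ηY, lt_min hη₁ hηY, ?_⟩
  intro a₀ θ₀ u₀ ha₀ hθ₀ hu₀ ha₀p hθ₀p
  obtain ⟨σ₀, hσ₀, H2⟩ := H1 a₀ θ₀ u₀ ha₀ hθ₀ hu₀ ha₀p hθ₀p
  refine ⟨σ₀, hσ₀, ?_⟩
  intro σ hσ hσlt T ρ θ u hEul Φ hLLN τ hτ hτT χ hχ g hg hg0 k l η δ hη hδ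
  have hg0' : ∀ a, η₁ ≤ a → g a = 0 := fun a ha => hg0 a ((min_le_left _ _).trans ha)
  have hkc : Continuous fun a => g a * Yt a * a := weight_continuous hg hYt
  have hk0 : ∀ a, η₁ ≤ a → g a * Yt a * a = 0 := weight_eq_zero_of_le hg0'
  obtain ⟨r₀, hr₀, H3⟩ := H2 σ hσ hσlt T ρ θ u hEul Φ hLLN τ hτ hτT χ hχ (fun a => g a * Yt a * a) hkc hk0
    (fun q : V3 × V3 × ℝ => ∫ ω : Metric.sphere (0 : V3) 1,
      ⟪q.1 - q.2.1, (ω : V3)⟫_ℝ ^ 2 * ((ω : V3) k * (ω : V3) l) ∂sphereMeasure)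
    (continuous_secondMomentTest k l) (exists_abs_secondMomentTest_le k l) η δ hη hδ
  refine ⟨r₀, hr₀, fun r hr hrr => ?_⟩
  obtain ⟨N₀, H4⟩ := H3 r hr hrr
  refine ⟨N₀, fun N hN => ?_⟩
  obtain ⟨Ck, -, hkb⟩ := exists_bound_of_eq_zero_of_le hkc hη₁ hk0
  obtain ⟨CgY, -, hgY⟩ :=
    exists_bound_mul_contactValue_of_clamp hg hYt hYeq (lt_min hη₁ hηY) (min_le_right _ _) hg0
  have hkw : ∀ a, 0 ≤ a → g a * contactValue a * a = g a * Yt a * a := fun a ha =>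
    mul_contactValue_mul_eq_weight hYeq (min_le_right _ _) hg0 ha
  refine (measure_le_of_subset_union_null (localGibbsLaw σ a₀ u₀ θ₀ N (Φ N))
    (localGibbsLaw_compl_good (Φ N)) fun z hz => ?_).trans (H4 N hN)
  by_cases hzg : z ∈ (Φ N).good
  · refine Set.mem_union_left _ ?_
    rw [mem_setOf_eq] at hz ⊢
    rw [contactPredM_sub_enskog_eq_oneBodyPred_sub_oneBodyStat hσ.le (Φ N) hzg hr τ hχ hg hgY hkc hkb
      hkw (continuous_sphereMark_uncurry (continuous_evenMark k l)).measurable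
      (abs_sphereMark_evenMark_le' k l) (continuous_secondMomentTest k l)
      (CF := sphereMeasure.real (univ : Set (Metric.sphere (0 : V3) 1))) measureReal_nonneg
      (fun v u _ => abs_secondMomentTest_le k l v u) (fun w x => stub_enskogPointwise N k l r hr w x),
      abs_sub_comm] at hz
    exact hz
  · exact Set.mem_union_right _ (Set.mem_compl hzg)

/-- **THE GLUE OF THE RECOMMENDED SPLIT `EvenStressEnskogPreShock ⇐ ContactEvenPreShock ∧
VelocityEquilibrationPreShock`** (the `--glue-by` theorem of the planners' post-restatement decomposition of the
crux into its two-body core and its one-body half).  Hypotheses (spelled out): `hC` = `ContactEvenPreShock` (the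
pre-shock even contact law, the crux child), `hL1` = `VelocityEquilibrationPreShock` (pre-shock one-body velocity
equilibration in the second-moment-tested sense, the support child = the output of the route's kinetic half);
conclusion = `EvenStressEnskogPreShock`.  Stated as the registered sub-goal `(hC) → (hL1) → conclusion` of
stmt-AtomisticToContinuum-13079.  Proof: `evenStressEnskogPreShock_of_sides hC
(enskogSidePreShock_of_velocityEquilibrationPreShock hL1)` — the pre-shock re-threading of the landed `∀ τ`
reduction `evenStressEnskog_of_localGibbsTested`. [folklore] -/
theorem evenStressEnskogPreShock_of_contact_of_velocityEquilibration :
    (∃ η₀ : ℝ, 0 < η₀ ∧ ∀ (a₀ θ₀ : T3 → ℝ) (u₀ : T3 → V3), Continuous a₀ → Continuous θ₀ → Continuous u₀ →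
      (∀ x, 0 < a₀ x) → (∀ x, 0 < θ₀ x) → ∃ σ₀ : ℝ, 0 < σ₀ ∧ ∀ σ : ℝ, 0 < σ → σ < σ₀ →
      ∀ (T : ℝ) (ρ θ : ℝ → T3 → ℝ) (u : ℝ → T3 → V3), IsHardSphereEulerSolution σ T ρ u θ →
      ∀ Φ : (N : ℕ) → HardSphereFlow (Torus.geometry (Fin 3)) (hsDiameter σ N) (N + 1),
      TendstoHydroFieldsAt (fun N => localGibbsLaw σ a₀ u₀ θ₀ N (Φ N)) Φ ρ u θ 0 →
      ∀ τ : ℝ, 0 < τ → τ < T →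
      ∀ χ : ℝ × T3 → ℝ, Continuous χ → ∀ g : ℝ → ℝ, Continuous g → (∀ a, η₀ ≤ a → g a = 0) →
      ∀ k l : Fin 3,
      ∀ η δ : ℝ, 0 < η → 0 < δ → ∃ r₀ : ℝ, 0 < r₀ ∧ ∀ r : ℝ, 0 < r → r < r₀ → ∃ N₀ : ℕ, ∀ N : ℕ, N₀ ≤ N →
        localGibbsLaw σ a₀ u₀ θ₀ N (Φ N)
          {z | η < |collisionSum σ N (Φ N) τ χ g (evenMark k l) r z - contactPredM σ N (Φ N) τ χ g (evenMark k l) r z|}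
          ≤ ENNReal.ofReal δ) →
    (∃ η₀ : ℝ, 0 < η₀ ∧ ∀ (a₀ θ₀ : T3 → ℝ) (u₀ : T3 → V3), Continuous a₀ → Continuous θ₀ → Continuous u₀ →
      (∀ x, 0 < a₀ x) → (∀ x, 0 < θ₀ x) → ∃ σ₀ : ℝ, 0 < σ₀ ∧ ∀ σ : ℝ, 0 < σ → σ < σ₀ →
      ∀ (T : ℝ) (ρ θ : ℝ → T3 → ℝ) (u : ℝ → T3 → V3), IsHardSphereEulerSolution σ T ρ u θ →
      ∀ Φ : (N : ℕ) → HardSphereFlow (Torus.geometry (Fin 3)) (hsDiameter σ N) (N + 1),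
      TendstoHydroFieldsAt (fun N => localGibbsLaw σ a₀ u₀ θ₀ N (Φ N)) Φ ρ u θ 0 →
      ∀ τ : ℝ, 0 < τ → τ < T →
      ∀ χ : ℝ × T3 → ℝ, Continuous χ → ∀ k : ℝ → ℝ, Continuous k → (∀ a, η₀ ≤ a → k a = 0) →
      ∀ F : V3 × V3 × ℝ → ℝ, Continuous F →
      (∃ C : ℝ, ∀ q, |F q| ≤ C * (1 + ‖q.1‖ ^ 2 + ‖q.2.1‖ ^ 2 + |q.2.2|)) →
      ∀ η δ : ℝ, 0 < η → 0 < δ → ∃ r₀ : ℝ, 0 < r₀ ∧ ∀ r : ℝ, 0 < r → r < r₀ → ∃ N₀ : ℕ, ∀ N : ℕ, N₀ ≤ N →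
        localGibbsLaw σ a₀ u₀ θ₀ N (Φ N)
          {z | η < |oneBodyStat σ N (Φ N) τ χ k F r z - oneBodyPred σ N (Φ N) τ χ k F r z|}
          ≤ ENNReal.ofReal δ) →
    ∃ η₀ : ℝ, 0 < η₀ ∧ ∀ (a₀ θ₀ : T3 → ℝ) (u₀ : T3 → V3), Continuous a₀ → Continuous θ₀ → Continuous u₀ →
      (∀ x, 0 < a₀ x) → (∀ x, 0 < θ₀ x) → ∃ σ₀ : ℝ, 0 < σ₀ ∧ ∀ σ : ℝ, 0 < σ → σ < σ₀ →
      ∀ (T : ℝ) (ρ θ : ℝ → T3 → ℝ) (u : ℝ → T3 → V3), IsHardSphereEulerSolution σ T ρ u θ →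
      ∀ Φ : (N : ℕ) → HardSphereFlow (Torus.geometry (Fin 3)) (hsDiameter σ N) (N + 1),
      TendstoHydroFieldsAt (fun N => localGibbsLaw σ a₀ u₀ θ₀ N (Φ N)) Φ ρ u θ 0 →
      ∀ τ : ℝ, 0 < τ → τ < T →
      ∀ χ : ℝ × T3 → ℝ, Continuous χ → ∀ g : ℝ → ℝ, Continuous g → (∀ a, η₀ ≤ a → g a = 0) →
      ∀ η δ : ℝ, 0 < η → 0 < δ → ∃ r₀ : ℝ, 0 < r₀ ∧ ∀ r : ℝ, 0 < r → r < r₀ → ∃ N₀ : ℕ, ∀ N : ℕ, N₀ ≤ N →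
      ∀ k l : Fin 3,
        localGibbsLaw σ a₀ u₀ θ₀ N (Φ N) {z | η < |evenStat σ N (Φ N) τ χ g (evenMark k l) r z|}
          ≤ ENNReal.ofReal δ :=
  fun hC hL1 => evenStressEnskogPreShock_of_sides hC (enskogSidePreShock_of_velocityEquilibrationPreShock hL1)

/-- **THE WHOLE LINE, DEFINITION-FREE: the filed crux from the frame gap and the two pre-shock children.**
Hypotheses (spelled out): `hGap` = the line's frame gap `EvenStressEnskogPreShock → EvenStressEnskog` (open as
mathematics in the filed `∀ τ` frame; `id` once the crux is restated to the pre-shock frame), `hC` =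
`ContactEvenPreShock`, `hL1` = `VelocityEquilibrationPreShock`; conclusion = the filed `EvenStressEnskog`.
Proof: `hGap (evenStressEnskogPreShock_of_contact_of_velocityEquilibration hC hL1)`. [folklore] -/
theorem evenStressEnskog_of_frameGap_of_contact_of_velocityEquilibration
    (hGap : (∃ η₀ : ℝ, 0 < η₀ ∧ ∀ (a₀ θ₀ : T3 → ℝ) (u₀ : T3 → V3), Continuous a₀ → Continuous θ₀ → Continuous u₀ →
      (∀ x, 0 < a₀ x) → (∀ x, 0 < θ₀ x) → ∃ σ₀ : ℝ, 0 < σ₀ ∧ ∀ σ : ℝ, 0 < σ → σ < σ₀ →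
      ∀ (T : ℝ) (ρ θ : ℝ → T3 → ℝ) (u : ℝ → T3 → V3), IsHardSphereEulerSolution σ T ρ u θ →
      ∀ Φ : (N : ℕ) → HardSphereFlow (Torus.geometry (Fin 3)) (hsDiameter σ N) (N + 1),
      TendstoHydroFieldsAt (fun N => localGibbsLaw σ a₀ u₀ θ₀ N (Φ N)) Φ ρ u θ 0 →
      ∀ τ : ℝ, 0 < τ → τ < T →
      ∀ χ : ℝ × T3 → ℝ, Continuous χ → ∀ g : ℝ → ℝ, Continuous g → (∀ a, η₀ ≤ a → g a = 0) →
      ∀ η δ : ℝ, 0 < η → 0 < δ → ∃ r₀ : ℝ, 0 < r₀ ∧ ∀ r : ℝ, 0 < r → r < r₀ → ∃ N₀ : ℕ, ∀ N : ℕ, N₀ ≤ N →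
      ∀ k l : Fin 3,
        localGibbsLaw σ a₀ u₀ θ₀ N (Φ N) {z | η < |evenStat σ N (Φ N) τ χ g (evenMark k l) r z|}
          ≤ ENNReal.ofReal δ) → EvenStressEnskog)
    (hC : ∃ η₀ : ℝ, 0 < η₀ ∧ ∀ (a₀ θ₀ : T3 → ℝ) (u₀ : T3 → V3), Continuous a₀ → Continuous θ₀ → Continuous u₀ →
      (∀ x, 0 < a₀ x) → (∀ x, 0 < θ₀ x) → ∃ σ₀ : ℝ, 0 < σ₀ ∧ ∀ σ : ℝ, 0 < σ → σ < σ₀ →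
      ∀ (T : ℝ) (ρ θ : ℝ → T3 → ℝ) (u : ℝ → T3 → V3), IsHardSphereEulerSolution σ T ρ u θ →
      ∀ Φ : (N : ℕ) → HardSphereFlow (Torus.geometry (Fin 3)) (hsDiameter σ N) (N + 1),
      TendstoHydroFieldsAt (fun N => localGibbsLaw σ a₀ u₀ θ₀ N (Φ N)) Φ ρ u θ 0 →
      ∀ τ : ℝ, 0 < τ → τ < T →
      ∀ χ : ℝ × T3 → ℝ, Continuous χ → ∀ g : ℝ → ℝ, Continuous g → (∀ a, η₀ ≤ a → g a = 0) →
      ∀ k l : Fin 3,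
      ∀ η δ : ℝ, 0 < η → 0 < δ → ∃ r₀ : ℝ, 0 < r₀ ∧ ∀ r : ℝ, 0 < r → r < r₀ → ∃ N₀ : ℕ, ∀ N : ℕ, N₀ ≤ N →
        localGibbsLaw σ a₀ u₀ θ₀ N (Φ N)
          {z | η < |collisionSum σ N (Φ N) τ χ g (evenMark k l) r z - contactPredM σ N (Φ N) τ χ g (evenMark k l) r z|}
          ≤ ENNReal.ofReal δ)
    (hL1 : ∃ η₀ : ℝ, 0 < η₀ ∧ ∀ (a₀ θ₀ : T3 → ℝ) (u₀ : T3 → V3), Continuous a₀ → Continuous θ₀ → Continuous u₀ →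
      (∀ x, 0 < a₀ x) → (∀ x, 0 < θ₀ x) → ∃ σ₀ : ℝ, 0 < σ₀ ∧ ∀ σ : ℝ, 0 < σ → σ < σ₀ →
      ∀ (T : ℝ) (ρ θ : ℝ → T3 → ℝ) (u : ℝ → T3 → V3), IsHardSphereEulerSolution σ T ρ u θ →
      ∀ Φ : (N : ℕ) → HardSphereFlow (Torus.geometry (Fin 3)) (hsDiameter σ N) (N + 1),
      TendstoHydroFieldsAt (fun N => localGibbsLaw σ a₀ u₀ θ₀ N (Φ N)) Φ ρ u θ 0 →
      ∀ τ : ℝ, 0 < τ → τ < T →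
      ∀ χ : ℝ × T3 → ℝ, Continuous χ → ∀ k : ℝ → ℝ, Continuous k → (∀ a, η₀ ≤ a → k a = 0) →
      ∀ F : V3 × V3 × ℝ → ℝ, Continuous F →
      (∃ C : ℝ, ∀ q, |F q| ≤ C * (1 + ‖q.1‖ ^ 2 + ‖q.2.1‖ ^ 2 + |q.2.2|)) →
      ∀ η δ : ℝ, 0 < η → 0 < δ → ∃ r₀ : ℝ, 0 < r₀ ∧ ∀ r : ℝ, 0 < r → r < r₀ → ∃ N₀ : ℕ, ∀ N : ℕ, N₀ ≤ N →
        localGibbsLaw σ a₀ u₀ θ₀ N (Φ N)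
          {z | η < |oneBodyStat σ N (Φ N) τ χ k F r z - oneBodyPred σ N (Φ N) τ χ k F r z|}
          ≤ ENNReal.ofReal δ) :
    EvenStressEnskog :=
  hGap (evenStressEnskogPreShock_of_contact_of_velocityEquilibration hC hL1)

end Summit.AtomisticToContinuum.HydrodynamicLimit.Theorems.EvenStressEnskog

end
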